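import Mathlib
import Literature.Computability.AlgebraicComplexity.MatrixMultiplicationExponent
import Literature.Computability.AlgebraicComplexity.AlderStrassen

/-!
# `FidelityWitnesses.LinearDefectLaw`, line `border-singular-values`: `stub_freeUnitProduct`

Support file for crux item `stmt-MatrixMultiplication-14039`
(`Summit.MatrixMultiplication.MatrixMultiplication.Theses.FidelityWitnesses.LinearDefectLaw`), line
`border-singular-values`, registered stub `stub_freeUnitProduct` — THE FREE RUNGS BELOW THE WINDOW.

Slots: `S a b c` with `a = (κ,ν)` the output slot, `b = (κ,μ)`, `c = (μ,ν)`, all in `Fin n × Fin n`;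
`T := matMulTensor ℂ n n n`, `T a b c = [a.1 = b.1 ∧ b.2 = c.1 ∧ a.2 = c.2]`.

* `stub_freeUnitProduct` — for `r + 2 ≤ 2n` and EVERY tensor `S` of rank `≤ r` there are unit vectors
  `x y z : Fin n × Fin n → ℂ` with `Σ S a b c · x a · y b · z c = 0` and `Σ T a b c · x a · y b · z c = 1`.

Proof (kernel counting on a ROTATED UNIT PRODUCT). Write `S = Σ_{l < r} w_l ⊗ u_l ⊗ v_l`
(`exists_eq_sum_triad_of_tensorRank_le`). For unit `p q s : Fin n → ℂ` put
`x (κ,ν) := p κ q ν`, `y (κ,μ) := conj (p κ) s μ`, `z (μ,ν) := conj (s μ) conj (q ν)`: these are unit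
vectors (`sum_norm_sq_eq_one`), `T` evaluates on them to `(Σ|p|²)(Σ|q|²)(Σ|s|²) = 1`
(`ev_matMulTensor`), and `S` evaluates to `Σ_l A_l B_l C_l` with `A_l = Σ w_l · x` linear in `p` and
`B_l = Σ u_l · y` linear in `s` (`ev_sum_triad`). Take `q := e_0`; the `≤ n − 1` indices `l` with
`l + 1 < n` give `≤ n − 1 < n` linear functionals in `p`, so some unit `p` kills all these `A_l`
(`exists_unit_orth`, from `LinearMap.ker_ne_bot_of_finrank_lt`); the remaining `≤ r − (n − 1) ≤ n − 1`
indices give `< n` functionals in `s`, so some unit `s` kills those `B_l`. Every summand `A_l B_l C_l`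
then vanishes. Mathlib only, plus the tree definitions `triad`, `tensorRank`, `matMulTensor` and the tree
lemma `exists_eq_sum_triad_of_tensorRank_le`.
-/

set_option linter.dupNamespace false

namespace Summit.MatrixMultiplication.MatrixMultiplication.Theorems.LinearDefectLaw.FreeUnitProduct

open scoped BigOperators ComplexConjugate
open Literature.Computability.AlgebraicComplexity

/-! ## Kernel counting: a unit vector annihilated by fewer than `n` linear functionals -/

/-- Fewer than `n` linear functionals `p ↦ Σ_κ g l κ · p κ` on `ℂⁿ` have a common unit zero
(`Σ_κ ‖p κ‖² = 1`): rank–nullity (`LinearMap.ker_ne_bot_of_finrank_lt`) and normalisation. -/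
theorem exists_unit_orth {n : ℕ} {ι : Type} [Fintype ι] (hcard : Fintype.card ι < n)
    (g : ι → Fin n → ℂ) :
    ∃ p : Fin n → ℂ, (∑ κ, ‖p κ‖ ^ 2) = 1 ∧ ∀ l, (∑ κ, g l κ * p κ) = 0 := by
  have hlt : Module.finrank ℂ (ι → ℂ) < Module.finrank ℂ (Fin n → ℂ) := by
    rw [Module.finrank_fintype_fun_eq_card, Module.finrank_fin_fun]
    exact hcard
  obtain ⟨p₀, hp₀, hp₀ne⟩ := Submodule.exists_mem_ne_zero_of_ne_bot
    (LinearMap.ker_ne_bot_of_finrank_lt (f := Matrix.mulVecLin (Matrix.of g)) hlt)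
  have hker : ∀ l, ∑ κ, g l κ * p₀ κ = 0 := fun l => congr_fun (LinearMap.mem_ker.1 hp₀) l
  have hpos : 0 < ∑ κ, ‖p₀ κ‖ ^ 2 := by
    obtain ⟨κ, hκ⟩ : ∃ κ, p₀ κ ≠ 0 := by
      by_contra h
      push Not at h
      exact hp₀ne (funext h)
    exact lt_of_lt_of_le (by positivity) (Finset.single_le_sum (f := fun κ => ‖p₀ κ‖ ^ 2)
      (fun i _ => by positivity) (Finset.mem_univ κ))
  set N : ℝ := Real.sqrt (∑ κ, ‖p₀ κ‖ ^ 2) with hN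
  have hNpos : 0 < N := Real.sqrt_pos.2 hpos
  have hN2 : N ^ 2 = ∑ κ, ‖p₀ κ‖ ^ 2 := Real.sq_sqrt hpos.le
  refine ⟨fun κ => p₀ κ / N, ?_, fun l => ?_⟩
  · have h : ∀ κ, ‖p₀ κ / (N : ℂ)‖ ^ 2 = ‖p₀ κ‖ ^ 2 / N ^ 2 := fun κ => by
      rw [norm_div, Complex.norm_real, Real.norm_of_nonneg hNpos.le, div_pow]
    simp only [h]
    rw [← Finset.sum_div, ← hN2]
    exact div_self (pow_pos hNpos 2).ne'
  · have h : ∑ κ, g l κ * (p₀ κ / N) = (∑ κ, g l κ * p₀ κ) / N := by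
      rw [Finset.sum_div]
      exact Finset.sum_congr rfl fun κ _ => by ring
    rw [h, hker l, zero_div]

/-! ## Evaluating tensors on product vectors -/

/-- A product vector `a ↦ F a` with `‖F (κ,ν)‖ = ‖f κ‖ ‖g ν‖` of two unit vectors is a unit vector
of `ℂ^{Fin n × Fin n}`. -/
theorem sum_norm_sq_eq_one {n : ℕ} (F : Fin n × Fin n → ℂ) (f g : Fin n → ℂ)
    (hF : ∀ a, ‖F a‖ = ‖f a.1‖ * ‖g a.2‖) (hf : ∑ κ, ‖f κ‖ ^ 2 = 1) (hg : ∑ ν, ‖g ν‖ ^ 2 = 1) :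
    ∑ a, ‖F a‖ ^ 2 = 1 := by
  calc ∑ a, ‖F a‖ ^ 2 = ∑ a : Fin n × Fin n, ‖f a.1‖ ^ 2 * ‖g a.2‖ ^ 2 :=
        Finset.sum_congr rfl fun a _ => by rw [hF a, mul_pow]
    _ = (∑ κ, ‖f κ‖ ^ 2) * ∑ ν, ‖g ν‖ ^ 2 := by
        rw [Fintype.sum_prod_type, Finset.sum_mul_sum]
    _ = 1 := by rw [hf, hg, one_mul]

/-- The trilinear evaluation of a sum of `r` triads on `(x,y,z)` is `Σ_l A_l B_l C_l` with
`A_l = Σ_a w_l a x a`, `B_l = Σ_b u_l b y b`, `C_l = Σ_c v_l c z c`. -/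
theorem ev_sum_triad {n r : ℕ} (w u v : Fin r → Fin n × Fin n → ℂ) (x y z : Fin n × Fin n → ℂ) :
    ∑ a, ∑ b, ∑ c, (∑ l, triad (w l) (u l) (v l)) a b c * x a * y b * z c =
      ∑ l, (∑ a, w l a * x a) * (∑ b, u l b * y b) * (∑ c, v l c * z c) := by
  calc ∑ a, ∑ b, ∑ c, (∑ l, triad (w l) (u l) (v l)) a b c * x a * y b * z c
      = ∑ a, ∑ b, ∑ c, ∑ l, (w l a * x a) * (u l b * y b) * (v l c * z c) := by
        refine Finset.sum_congr rfl fun a _ => Finset.sum_congr rfl fun b _ =>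
          Finset.sum_congr rfl fun c _ => ?_
        rw [Finset.sum_apply, Finset.sum_apply, Finset.sum_apply, Finset.sum_mul, Finset.sum_mul,
          Finset.sum_mul]
        exact Finset.sum_congr rfl fun l _ => by rw [triad_apply]; ring
    _ = ∑ a, ∑ b, ∑ l, ∑ c, (w l a * x a) * (u l b * y b) * (v l c * z c) :=
        Finset.sum_congr rfl fun a _ => Finset.sum_congr rfl fun b _ => Finset.sum_comm
    _ = ∑ a, ∑ l, ∑ b, ∑ c, (w l a * x a) * (u l b * y b) * (v l c * z c) :=
        Finset.sum_congr rfl fun a _ => Finset.sum_comm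
    _ = ∑ l, ∑ a, ∑ b, ∑ c, (w l a * x a) * (u l b * y b) * (v l c * z c) := Finset.sum_comm
    _ = ∑ l, (∑ a, w l a * x a) * (∑ b, u l b * y b) * (∑ c, v l c * z c) := by
        refine Finset.sum_congr rfl fun l _ => ?_
        rw [Finset.sum_mul_sum, Finset.sum_mul]
        refine Finset.sum_congr rfl fun a _ => ?_
        rw [Finset.sum_mul]
        refine Finset.sum_congr rfl fun b _ => ?_
        rw [Finset.mul_sum]

/-- The trilinear evaluation of `⟨n,n,n⟩` on `(x,y,z)`: the indicator collapses the slots `b = (κ,μ)`,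
`c = (μ,ν)` given `a = (κ,ν)`, leaving `Σ_{κ,ν,μ} x (κ,ν) y (κ,μ) z (μ,ν)`. -/
theorem ev_matMulTensor {n : ℕ} (x y z : Fin n × Fin n → ℂ) :
    ∑ a, ∑ b, ∑ c, matMulTensor ℂ n n n a b c * x a * y b * z c =
      ∑ a : Fin n × Fin n, ∑ μ : Fin n, x a * y (a.1, μ) * z (μ, a.2) := by
  refine Finset.sum_congr rfl fun a _ => ?_
  have hc : ∀ b : Fin n × Fin n, ∑ c, matMulTensor ℂ n n n a b c * x a * y b * z c =
      if b.1 = a.1 then x a * y b * z (b.2, a.2) else 0 := by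
    intro b
    rw [Fintype.sum_eq_single (b.2, a.2)]
    · by_cases h : b.1 = a.1
      · simp [matMulTensor, h]
      · simp [matMulTensor, h, Ne.symm h]
    · intro c hc
      have h : ¬(a.1 = b.1 ∧ b.2 = c.1 ∧ a.2 = c.2) := by
        rintro ⟨-, h2, h3⟩
        exact hc (Prod.ext h2.symm h3.symm)
      simp [matMulTensor, h]
  rw [Finset.sum_congr rfl fun b _ => hc b, Fintype.sum_prod_type, Finset.sum_comm]
  simp

/-! ## The stub -/

/-- stub `stub_freeUnitProduct` of line `border-singular-values` for crux `LinearDefectLaw`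
(stmt-MatrixMultiplication-14039): below the window (r ≤ 2n − 2) every rank-≤ r tensor is annihilated
by a rotated unit product of ⟨n,n,n⟩. Precisely: for `r + 2 ≤ 2n` and `tensorRank S ≤ r` there are
unit vectors `x y z : Fin n × Fin n → ℂ` with `Σ S a b c x a y b z c = 0` and
`Σ ⟨n,n,n⟩ a b c x a y b z c = 1`; the witnesses are `x = p ⊗ e₀`, `y = p̄ ⊗ s`, `z = s̄ ⊗ e₀` with `p`
(resp. `s`) a unit vector in the common kernel of the `< n` functionals `A_l`, `l + 1 < n` (resp. `B_l`,
`l + 1 ≥ n`). -/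
theorem stub_freeUnitProduct :
    ∀ (n r : ℕ) (S : Fin n × Fin n → Fin n × Fin n → Fin n × Fin n → ℂ), r + 2 ≤ 2 * n → tensorRank S ≤ r →
      ∃ x y z : Fin n × Fin n → ℂ, (∑ i, ‖x i‖ ^ 2) = 1 ∧ (∑ i, ‖y i‖ ^ 2) = 1 ∧ (∑ i, ‖z i‖ ^ 2) = 1 ∧
        (∑ a, ∑ b, ∑ c, S a b c * x a * y b * z c) = 0 ∧
        (∑ a, ∑ b, ∑ c, matMulTensor ℂ n n n a b c * x a * y b * z c) = 1 := by
  intro n r S hr hS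
  have hn : 0 < n := by omega
  obtain ⟨w, u, v, hS'⟩ := exists_eq_sum_triad_of_tensorRank_le hS
  -- `q := e₀`, any unit vector
  obtain ⟨q, hq⟩ : ∃ q : Fin n → ℂ, ∑ ν, ‖q ν‖ ^ 2 = 1 := by
    refine ⟨Pi.single (⟨0, hn⟩ : Fin n) 1, ?_⟩
    rw [Fintype.sum_eq_single (⟨0, hn⟩ : Fin n) (fun ν hν => by rw [Pi.single_eq_of_ne hν]; simp)]
    simp
  -- `p`: a unit vector killing the functionals `A_l`, `l + 1 < n` (at most `n - 1` of them)
  have hcard₁ : Fintype.card {l : Fin r // l.val + 1 < n} < n := by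
    have h := Fintype.card_le_of_injective
      (fun l : {l : Fin r // l.val + 1 < n} => (⟨l.1.val, by have := l.2; omega⟩ : Fin (n - 1)))
      (fun l₁ l₂ h => by
        simp only [Fin.mk.injEq] at h
        exact Subtype.ext (Fin.ext h))
    rw [Fintype.card_fin] at h
    omega
  obtain ⟨p, hp, hpker⟩ := exists_unit_orth hcard₁
    (fun (l : {l : Fin r // l.val + 1 < n}) κ => ∑ ν, w l.1 (κ, ν) * q ν)
  -- `s`: a unit vector killing the functionals `B_l`, `l + 1 ≥ n` (at most `r - (n - 1) ≤ n - 1` of them)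
  have hcard₂ : Fintype.card {l : Fin r // ¬(l.val + 1 < n)} < n := by
    have h := Fintype.card_le_of_injective
      (fun l : {l : Fin r // ¬(l.val + 1 < n)} =>
        (⟨l.1.val - (n - 1), by have := l.2; have := l.1.isLt; omega⟩ : Fin (n - 1)))
      (fun l₁ l₂ h => by
        have h' : l₁.1.val - (n - 1) = l₂.1.val - (n - 1) := congrArg Fin.val h
        have h₁ := l₁.2
        have h₂ := l₂.2
        exact Subtype.ext (Fin.ext (by omega)))
    rw [Fintype.card_fin] at h
    omega
  obtain ⟨s, hs, hsker⟩ := exists_unit_orth hcard₂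
    (fun (l : {l : Fin r // ¬(l.val + 1 < n)}) μ => ∑ κ, u l.1 (κ, μ) * conj (p κ))
  -- the rotated unit product `x = p ⊗ q`, `y = p̄ ⊗ s`, `z = s̄ ⊗ q̄`
  have h1 : ∑ a : Fin n × Fin n, ‖p a.1 * q a.2‖ ^ 2 = 1 :=
    sum_norm_sq_eq_one _ p q (fun a => norm_mul _ _) hp hq
  have h2 : ∑ b : Fin n × Fin n, ‖conj (p b.1) * s b.2‖ ^ 2 = 1 :=
    sum_norm_sq_eq_one _ p s (fun b => by rw [norm_mul, Complex.norm_conj]) hp hs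
  have h3 : ∑ c : Fin n × Fin n, ‖conj (s c.1) * conj (q c.2)‖ ^ 2 = 1 :=
    sum_norm_sq_eq_one _ s q (fun c => by rw [norm_mul, Complex.norm_conj, Complex.norm_conj]) hs hq
  have h4 : ∑ a, ∑ b, ∑ c, S a b c * (p a.1 * q a.2) * (conj (p b.1) * s b.2) *
      (conj (s c.1) * conj (q c.2)) = 0 := by
    rw [hS', ev_sum_triad]
    refine Finset.sum_eq_zero fun l _ => ?_
    by_cases hl : l.val + 1 < n
    · -- `A_l = 0`
      have hA : ∑ a : Fin n × Fin n, w l a * (p a.1 * q a.2) = ∑ κ, (∑ ν, w l (κ, ν) * q ν) * p κ := by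
        rw [Fintype.sum_prod_type]
        refine Finset.sum_congr rfl fun κ _ => ?_
        rw [Finset.sum_mul]
        exact Finset.sum_congr rfl fun ν _ => by ring
      have h0 : ∑ κ, (∑ ν, w l (κ, ν) * q ν) * p κ = 0 := hpker ⟨l, hl⟩
      rw [hA, h0, zero_mul, zero_mul]
    · -- `B_l = 0`
      have hB : ∑ b : Fin n × Fin n, u l b * (conj (p b.1) * s b.2) =
          ∑ μ, (∑ κ, u l (κ, μ) * conj (p κ)) * s μ := by
        rw [Fintype.sum_prod_type, Finset.sum_comm]
        refine Finset.sum_congr rfl fun μ _ => ?_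
        rw [Finset.sum_mul]
        exact Finset.sum_congr rfl fun κ _ => by ring
      have h0 : ∑ μ, (∑ κ, u l (κ, μ) * conj (p κ)) * s μ = 0 := hsker ⟨l, hl⟩
      rw [hB, h0, mul_zero, zero_mul]
  have hpC : ∑ κ, (‖p κ‖ : ℂ) ^ 2 = 1 := by exact_mod_cast hp
  have hqC : ∑ ν, (‖q ν‖ : ℂ) ^ 2 = 1 := by exact_mod_cast hq
  have hsC : ∑ μ, (‖s μ‖ : ℂ) ^ 2 = 1 := by exact_mod_cast hs
  have h5 : ∑ a, ∑ b, ∑ c, matMulTensor ℂ n n n a b c * (p a.1 * q a.2) * (conj (p b.1) * s b.2) *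
      (conj (s c.1) * conj (q c.2)) = 1 := by
    calc _ = ∑ a : Fin n × Fin n, ∑ μ : Fin n,
          p a.1 * q a.2 * (conj (p a.1) * s μ) * (conj (s μ) * conj (q a.2)) :=
          ev_matMulTensor (fun a => p a.1 * q a.2) (fun b => conj (p b.1) * s b.2)
            (fun c => conj (s c.1) * conj (q c.2))
      _ = ∑ a : Fin n × Fin n, ∑ μ : Fin n, (‖p a.1‖ : ℂ) ^ 2 * (‖q a.2‖ : ℂ) ^ 2 * (‖s μ‖ : ℂ) ^ 2 := by
          refine Finset.sum_congr rfl fun a _ => Finset.sum_congr rfl fun μ _ => ?_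
          rw [← Complex.mul_conj', ← Complex.mul_conj', ← Complex.mul_conj']
          ring
      _ = (∑ κ, (‖p κ‖ : ℂ) ^ 2) * (∑ ν, (‖q ν‖ : ℂ) ^ 2) * ∑ μ, (‖s μ‖ : ℂ) ^ 2 := by
          rw [Fintype.sum_prod_type, Finset.sum_mul_sum]
          simp_rw [Finset.sum_mul, Finset.mul_sum]
      _ = 1 := by rw [hpC, hqC, hsC, one_mul, one_mul]
  exact ⟨fun a => p a.1 * q a.2, fun b => conj (p b.1) * s b.2, fun c => conj (s c.1) * conj (q c.2),
    h1, h2, h3, h4, h5⟩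

end Summit.MatrixMultiplication.MatrixMultiplication.Theorems.LinearDefectLaw.FreeUnitProduct
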